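import Summits.KontsevichZagierPeriods.KontsevichZagierPeriods.Theorems.FermatIsogenyBetaLinearSectorStubTwoTermRelation
import Summits.KontsevichZagierPeriods.KontsevichZagierPeriods.Theorems.FermatIsogenyBetaLinearSectorStubRungOfArcRelation
import Summits.KontsevichZagierPeriods.KontsevichZagierPeriods.Theorems.FermatIsogenyBetaLinearSectorStubPinnedReflect
import Summits.KontsevichZagierPeriods.KontsevichZagierPeriods.Theorems.FermatIsogenyBetaLinearSectorStubFermatS3Class
import Mathlib.RingTheory.Algebraic.Basic
import HarnessLib

/-!
# `BetaLinearSector` (stmt-KontsevichZagierPeriods-3897) — section `Sector`: THE FERMAT REFLECTION RUNG (all levels)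

Registered stub `stub_fermatReflectionRung` of line `fermat-sector-transport` (lead c4): **the Fermat reflection class of the
crux at ALL levels** — for positive rationals with `a + b + a′ = 1`, `b′ = b` (so that
`B(a,b) = [sin π(a+b)/sin πa]·B(a′,b′)`, the S₃-symmetry of `F_N` exchanging the cusp groups `x = 0` and `z = 0`), the two pinned
Kontsevich–Zagier representations `[x^{a−1}(1−x)^{b−1}]`, `[c·x^{a′−1}(1−x)^{b′−1}]` on `(0,1)` with the same value are
KZ-equivalent.  No transcendence input: `c` is forced.  Composition of the registered stubs `stub_twoTermRelation` (the
explicit elementary decomposition of the two-term symbol relation: Cauchy on the Fermat sector) and `stub_rungOfArcRelation`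
(the transfer through the landed retraction `Θ` and the Green lemma) at the common level `N = den(a)·den(b)`.

References: M. Kontsevich, D. Zagier, *Periods* (2001), §1.2; B. Gross (appendix by D. Rohrlich), Invent. Math. 45 (1978), §1.
-/

noncomputable section

namespace Summit.KontsevichZagierPeriods.FermatIsogeny.BetaLinearSector

open scoped BigOperators
open MeasureTheory Set MvPolynomial
open Literature.NumberTheory.Transcendental Literature.NumberTheory.Transcendental.CurvePeriods

/-- `sin(πm/N)` is an algebraic number (`= (ε^m − ε̄^m)/(2i)`, `ε = e^{iπ/N}`). [folklore] -/
theorem fermatReflection_isAlgebraic_sin {N : ℕ} (hN : N ≠ 0) (m : ℕ) :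
    IsAlgebraic ℚ (Real.sin (Real.pi * m / N)) := by
  have hI : IsAlgebraic ℚ Complex.I := by
    refine ⟨Polynomial.X ^ 2 + Polynomial.C 1, (Polynomial.monic_X_pow_add_C (1:ℚ) two_ne_zero).ne_zero, ?_⟩
    simp
  have h2 : IsAlgebraic ℚ (2 : ℂ) := by simpa using isAlgebraic_algebraMap (R := ℚ) (A := ℂ) (2 : ℚ)
  have hC : IsAlgebraic ℚ ((Real.sin (Real.pi * m / N) : ℝ) : ℂ) := by
    have h : ((Real.sin (Real.pi * m / N) : ℝ) : ℂ) =
        (Complex.exp (↑Real.pi * Complex.I / (N : ℂ)) ^ m - Complex.exp (-(↑Real.pi * Complex.I / (N : ℂ))) ^ m) *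
          (2 * Complex.I)⁻¹ := by
      rw [twoTerm_pow_sub_pow, Complex.ofReal_sin]; push_cast; field_simp
    rw [h]
    exact (((sectorPaths_algebraic_eps hN).pow m).sub ((sectorPaths_algebraic_epsBar hN).pow m)).mul
      (h2.mul hI).inv
  exact (isAlgebraic_algebraMap_iff (R := ℚ) (A := ℂ) Complex.ofReal_injective).mp hC

/-- **THE FERMAT REFLECTION RUNG** (registered stub `stub_fermatReflectionRung`): the reflection class
`(a, b) ~ (1 − a − b, b)` of the crux `BetaLinearSector` at ALL levels, unconditionally — for positive rationals with
`a + b + a′ = 1`, `b′ = b`, a real algebraic `c` and the two pinned representations with equal values, `KZ.Equivalent r r′`.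
[cite: KontsevichZagier2001, §1.2] [cite: Gross1978, §1 (Rohrlich's appendix)] -/
theorem stub_fermatReflectionRung : ∀ (a b a' b' : ℚ) (c : ℝ), 0 < a → 0 < b → 0 < a' → 0 < b' → IsAlgebraic ℚ c →
    a + b + a' = 1 → b' = b →
    ∀ (r r' : KZ.IntegralRep 1),
      r.domain = {x | x 0 ∈ Set.Ioo (0:ℝ) 1} →
      Set.EqOn r.integrand (fun x => (x 0) ^ ((a:ℝ) - 1) * (1 - x 0) ^ ((b:ℝ) - 1)) r.domain →
      r'.domain = {x | x 0 ∈ Set.Ioo (0:ℝ) 1} →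
      Set.EqOn r'.integrand (fun x => c * (x 0) ^ ((a':ℝ) - 1) * (1 - x 0) ^ ((b':ℝ) - 1)) r'.domain →
      r.value = r'.value → KZ.Equivalent r r' := by
  intro a b a' b' c ha hb ha' _ _ hsum hb' ρ ρ' hd hi hd' hi' hv
  have hb'R : (b' : ℝ) = b := by exact_mod_cast hb'
  -- level `N` and numerators: `a = r/N`, `b = s/N`
  obtain ⟨N, r, s, hN, hr, hs, haN, hbN⟩ : ∃ N r s : ℕ, 1 ≤ N ∧ 1 ≤ r ∧ 1 ≤ s ∧
      (a : ℝ) = (r : ℝ) / N ∧ (b : ℝ) = (s : ℝ) / N := by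
    refine ⟨a.den * b.den, a.num.toNat * b.den, b.num.toNat * a.den, Nat.one_le_iff_ne_zero.2
      (Nat.mul_ne_zero a.den_nz b.den_nz), ?_, ?_, ?_, ?_⟩
    · exact Nat.one_le_iff_ne_zero.2 (Nat.mul_ne_zero (by
        have := Rat.num_pos.2 ha; omega) b.den_nz)
    · exact Nat.one_le_iff_ne_zero.2 (Nat.mul_ne_zero (by
        have := Rat.num_pos.2 hb; omega) a.den_nz)
    · have hnum : ((a.num.toNat : ℕ) : ℝ) = (a.num : ℝ) := by
        have h0 : 0 ≤ a.num := (Rat.num_pos.2 ha).le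
        exact_mod_cast Int.toNat_of_nonneg h0
      have hq : (a : ℝ) = (a.num : ℝ) / (a.den : ℝ) := by exact_mod_cast (Rat.num_div_den a).symm
      rw [hq]
      push_cast
      rw [hnum]
      have hb0 : (b.den : ℝ) ≠ 0 := by exact_mod_cast b.den_nz
      have ha0 : (a.den : ℝ) ≠ 0 := by exact_mod_cast a.den_nz
      field_simp
    · have hnum : ((b.num.toNat : ℕ) : ℝ) = (b.num : ℝ) := by
        have h0 : 0 ≤ b.num := (Rat.num_pos.2 hb).le
        exact_mod_cast Int.toNat_of_nonneg h0
      have hq : (b : ℝ) = (b.num : ℝ) / (b.den : ℝ) := by exact_mod_cast (Rat.num_div_den b).symm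
      rw [hq]
      push_cast
      rw [hnum]
      have hb0 : (b.den : ℝ) ≠ 0 := by exact_mod_cast b.den_nz
      have ha0 : (a.den : ℝ) ≠ 0 := by exact_mod_cast a.den_nz
      field_simp
  -- the third numerator `t = N − r − s ≥ 1` (`a′ = 1 − a − b > 0`)
  have hNr : (0:ℝ) < N := by exact_mod_cast (show 0 < N by omega)
  have ha'R : (a' : ℝ) = 1 - (r : ℝ) / N - (s : ℝ) / N := by
    have h : (a' : ℚ) = 1 - a - b := by linarith
    rw [← haN, ← hbN]; exact_mod_cast h
  have hlt : r + s < N := by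
    have h0 : (0:ℝ) < a' := by exact_mod_cast ha'
    rw [ha'R] at h0
    have : ((r:ℝ) + s) / N < 1 := by rw [add_div]; linarith
    rw [div_lt_one hNr] at this
    exact_mod_cast this
  obtain ⟨t, ht, hsum'⟩ : ∃ t : ℕ, 1 ≤ t ∧ r + s + t = N := ⟨N - r - s, by omega, by omega⟩
  have htN : (a' : ℝ) = (t : ℝ) / N := by
    rw [ha'R]
    have : (t : ℝ) = N - r - s := by
      have h : ((r : ℝ) + s + t = N) := by exact_mod_cast hsum'
      linarith
    rw [this]
    field_simp
  have hN3 : 3 ≤ N := by omega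
  have hN0 : N ≠ 0 := by omega
  -- the two-term relation at level `N` and the transfer
  have hκ : IsAlgebraic ℚ (Real.sin (Real.pi * (r + s) / N) / Real.sin (Real.pi * r / N)) := by
    have h1 := fermatReflection_isAlgebraic_sin hN0 (r + s)
    have h2 := fermatReflection_isAlgebraic_sin hN0 r
    push_cast at h1
    exact h1.mul h2.inv
  refine stub_rungOfArcRelation N r s t hr hs ht hsum' _ hκ
    (fun hZ hω hω' γ hγ => stub_twoTermRelation N r s t hN3 hr hs ht hsum' hZ hω hω' γ hγ) c ρ ρ' hd ?_ hd' ?_ hv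
  · intro x hx
    rw [hi hx, haN, hbN]
  · intro x hx
    rw [hi' hx, htN, hb'R, hbN]


/-- **THE OBVIOUS KOBLITZ–ROHRLICH CLASS AT ALL LEVELS** (composition of the reflection rung with the landed two-sided form
`stub_pinnedReflect` and the `S₃ × ℤ²`-orbit combinatorics `stub_fermatS3Class`): Conjecture 1 of Kontsevich–Zagier for every pair of
Beta integrals `[∫₀¹x^{a−1}(1−x)^{b−1}dx]`, `[∫₀¹ c·x^{a′−1}(1−x)^{b′−1}dx]` with `(a, b)`, `(a′, b′)` congruent modulo `ℤ²` to two members of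
the `S₃`-orbit `{(a₀,b₀), (b₀,a₀), (t₀,b₀), (b₀,t₀), (a₀,t₀), (t₀,a₀)}`, `t₀ = 1 − a₀ − b₀`, of a holomorphic triple (`a₀, b₀ > 0`,
`a₀ + b₀ < 1`) — every "obvious" coincidence of Koblitz–Rohrlich among holomorphic differentials of `F_N`, every level `N`, no
transcendence input. [cite: KoblitzRohrlich1978, p. 1184] [cite: KontsevichZagier2001, §1.2] -/
theorem betaLinearSector_fermatS3Class : ∀ (a b a' b' : ℚ) (c : ℝ), 0 < a → 0 < b → 0 < a' → 0 < b' → IsAlgebraic ℚ c →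
    (∃ (a₀ b₀ a₁ b₁ : ℚ) (i j i' j' : ℤ), 0 < a₀ ∧ 0 < b₀ ∧ a₀ + b₀ < 1 ∧
      a = a₀ + i ∧ b = b₀ + j ∧ a' = a₁ + i' ∧ b' = b₁ + j' ∧
      ((a₁ = a₀ ∧ b₁ = b₀) ∨ (a₁ = b₀ ∧ b₁ = a₀) ∨ (a₁ = 1 - a₀ - b₀ ∧ b₁ = b₀) ∨ (a₁ = b₀ ∧ b₁ = 1 - a₀ - b₀) ∨
        (a₁ = a₀ ∧ b₁ = 1 - a₀ - b₀) ∨ (a₁ = 1 - a₀ - b₀ ∧ b₁ = a₀))) →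
    ∀ (r r' : KZ.IntegralRep 1),
      r.domain = {x | x 0 ∈ Set.Ioo (0:ℝ) 1} →
      Set.EqOn r.integrand (fun x => (x 0) ^ ((a:ℝ) - 1) * (1 - x 0) ^ ((b:ℝ) - 1)) r.domain →
      r'.domain = {x | x 0 ∈ Set.Ioo (0:ℝ) 1} →
      Set.EqOn r'.integrand (fun x => c * (x 0) ^ ((a':ℝ) - 1) * (1 - x 0) ^ ((b':ℝ) - 1)) r'.domain →
      r.value = r'.value → KZ.Equivalent r r' :=
  stub_fermatS3Class (stub_pinnedReflect stub_fermatReflectionRung)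

end Summit.KontsevichZagierPeriods.FermatIsogeny.BetaLinearSector

end
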